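import Literature.NumberTheory.Automorphic.UnitaryGroupPureTensorEulerProduct
import HarnessLib

/-!
# Integrals of pure tensors on `U(H)(𝔸_{L⁺})`, III: enlarging the bad set, arbitrary levels at finitely many places

Topic `NumberTheory/Automorphic`; namespace `Literature.NumberTheory.Automorphic.UnitaryGroup.PureTensor`. THEOREMS ONLY
(no definition, no instance, no named fact, no `sorry`).

Sequel of `UnitaryGroupPureTensorEulerProduct` (**(F)** `exists_integral_eval_eq_mul_integral_arch_mul_prod`: for a pure tensor
`T = f_∞ ⊗ ⊗_v f_v` whose levels off its bad set `T.S` are the integral levels `U(H)(𝒪_v)`,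
`∫ T.eval dν = κ · ∫ f_∞ dμ_∞ · ∏_{v ∈ T.S} ∫ f_v dm_v`). In the comparison of trace formulae ([Rogawski1990] §14.2)
the two test functions `f = ⊗ f_v`, `f′ = ⊗ f′_v` are unramified only off a COMMON finite set `S′ ⊇ S`, and at the
finitely many `v ∈ S′ ∖ S` the level `K_v` of `f_v = 1_{K_v}` is an arbitrary compact open subgroup (a deeper
congruence level at the ramified places). This file removes the restriction:

* `eval_eq_of_subset` — the evaluation of a pure tensor depends only on `(K, (f_v)_v, f_∞)` and is unchanged when
  the bad set is ENLARGED (the extra factors `f_v = 1_{K_v}`, `v ∈ S′ ∖ S`, reproduce the level condition);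
* **`exists_integral_eval_eq_mul_integral_arch_mul_prod_of_subset`** — ONE `κ > 0` such that for every pure tensor
  `T` and every finite `S′ ⊇ T.S` off which the levels are integral,
  `∫ T.eval dν = κ · ∫ f_∞ dμ_∞ · ∏_{v ∈ S′} ∫ f_v dm_v`;
* `exists_integral_eval_eq_mul_integral_arch_mul_prod_mul_prod_measureReal` — the same with the extra factors
  evaluated, `∏_{v ∈ S′ ∖ S} m_v(K_v)` (levels measurable, e.g. open).

Borel–Jacquet (1979) §4.1 (factorizable functions on `G(𝔸)`); the computation behind [Rogawski1990] §14.2 p. 233.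
Written for the cell `pub/hodgecm-mathlib`, ENGINE T1 line `F0_T1InnerFormTraceIdentity` (brick B13, item O13d).
HC_CM is proved only modulo the printed citations until rung 0 closes; this file is unconditional.

## References

* A. Borel, H. Jacquet, *Automorphic forms and automorphic representations*, PSPM 33.1 (1979), §4.1 [BorelJacquet1979].
* J. D. Rogawski, *Automorphic Representations of Unitary Groups in Three Variables*, Annals of Math. Studies 123
  (1990), §14.2 p. 233 [Rogawski1990].
-/

noncomputable section

open MeasureTheory NumberField IsDedekindDomain Set Filter
open scoped NNReal ENNReal

namespace Literature.NumberTheory.Automorphic.UnitaryGroup.PureTensor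

variable {L : Type} [Field L] [NumberField L] [IsCMField L] {N : ℕ} {H : Matrix (Fin N) (Fin N) L}

/-- **Enlarging the bad set does not change the function.** If `T′` has the same levels, local factors and
archimedean factor as `T` and a LARGER bad set `T.S ⊆ T′.S`, then `T′.eval = T.eval`: for `v ∈ T′.S ∖ T.S` the
factor `f_v = 1_{K_v}` of `T′` is `1` exactly on the level condition `g_v ∈ K_v` that `T` imposes at `v`.
[cite: BorelJacquet1979, §4.1] [cite: Rogawski1990, §14.2 p. 233] -/
theorem eval_eq_of_subset (T T' : PureTensor L N H) (hS : T.S ⊆ T'.S) (hK : ∀ v, T'.K v = T.K v)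
    (hloc : ∀ v, T'.loc v = T.loc v) (harch : T'.arch = T.arch) : T'.eval = T.eval := by
  classical
  funext g
  by_cases h' : ∀ v ∉ T'.S, (cmDatum L N H).toLocal v g ∈ T'.K v
  · by_cases h : ∀ v ∉ T.S, (cmDatum L N H).toLocal v g ∈ T.K v
    · rw [T.eval_eq_of_forall_mem g h, T'.eval_eq_of_forall_mem g h', harch, ← Finset.prod_sdiff hS]
      have h1 : ∏ v ∈ T'.S \ T.S, T'.loc v ((cmDatum L N H).toLocal v g) = 1 := by
        refine Finset.prod_eq_one fun v hv => ?_
        rw [Finset.mem_sdiff] at hv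
        rw [hloc v]
        exact T.loc_apply_of_mem hv.2 (h v hv.2)
      rw [h1, one_mul]
      exact congrArg _ (Finset.prod_congr rfl fun v _ => by rw [hloc v])
    · push Not at h
      obtain ⟨v, hv, hgv⟩ := h
      have hvS' : v ∈ T'.S := by
        by_contra hv'
        exact hgv (hK v ▸ h' v hv')
      rw [T.eval_eq_zero_of_not_mem g hv hgv, T'.eval_eq_of_forall_mem g h']
      refine mul_eq_zero_of_right _ (Finset.prod_eq_zero hvS' ?_)
      rw [hloc v]
      exact T.loc_apply_of_not_mem hv hgv
  · push Not at h'
    obtain ⟨v, hv', hgv⟩ := h'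
    have hv : v ∉ T.S := fun h => hv' (hS h)
    rw [hK v] at hgv
    rw [T'.eval_eq_zero_of_not_mem g hv' (by rwa [hK v]), T.eval_eq_zero_of_not_mem g hv hgv]

/-- **Euler factorisation with an enlarged bad set / arbitrary levels at finitely many places.** For Haar
measures `ν` on `U(H)(𝔸_{L⁺})`, `μ_∞` on `U(H)(L⁺ ⊗ ℝ)` and local Haar measures `m_v` with `m_v(U(H)(𝒪_v)) = 1`,
there is ONE `κ > 0` such that for every pure tensor `T` and every finite set `S′ ⊇ T.S` of finite places off
which the levels of `T` are the integral levels (`K_v` ARBITRARY for `v ∈ S′ ∖ T.S`),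
`∫ T.eval dν = κ · (∫ f_∞ dμ_∞) · ∏_{v ∈ S′} ∫ f_v dm_v` (no integrability hypotheses; for `v ∈ S′ ∖ T.S` the
factor is `∫ 1_{K_v} dm_v`). [cite: BorelJacquet1979, §4.1] [cite: Rogawski1990, §14.2 p. 233] -/
theorem exists_integral_eval_eq_mul_integral_arch_mul_prod_of_subset
    [MeasurableSpace (adelic (↥(maximalRealSubfield L)) L (IsCMField.complexConj L) N H)]
    [BorelSpace (adelic (↥(maximalRealSubfield L)) L (IsCMField.complexConj L) N H)]
    [MeasurableSpace (UnitaryGroup.arch (↥(maximalRealSubfield L)) L (IsCMField.complexConj L) N H)]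
    [BorelSpace (UnitaryGroup.arch (↥(maximalRealSubfield L)) L (IsCMField.complexConj L) N H)]
    [∀ v, MeasurableSpace ((cmDatum L N H).Local v)] [∀ v, BorelSpace ((cmDatum L N H).Local v)]
    (ν : Measure (adelic (↥(maximalRealSubfield L)) L (IsCMField.complexConj L) N H)) [ν.IsHaarMeasure]
    (μa : Measure (UnitaryGroup.arch (↥(maximalRealSubfield L)) L (IsCMField.complexConj L) N H)) [μa.IsHaarMeasure]
    (m : ∀ v, Measure ((cmDatum L N H).Local v)) [∀ v, (m v).IsHaarMeasure]
    (hm : ∀ v, m v (cmLocalIntegralLevel L N H v) = 1) :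
    ∃ κ : ℝ, 0 < κ ∧ ∀ (T : PureTensor L N H) (S' : Finset (HeightOneSpectrum (𝓞 ↥(maximalRealSubfield L)))),
      T.S ⊆ S' → (∀ v ∉ S', T.K v = cmLocalIntegralLevel L N H v) →
      ∫ g, T.eval g ∂ν = (κ : ℂ) * ((∫ a, T.arch a ∂μa) * ∏ v ∈ S', ∫ x, T.loc v x ∂(m v)) := by
  obtain ⟨κ, hκ, h⟩ := exists_integral_eval_eq_mul_integral_arch_mul_prod (L := L) (N := N) (H := H) ν μa m hm
  refine ⟨κ, hκ, fun T S' hS hK => ?_⟩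
  -- the same data with the bad set enlarged to `S'`
  let T' : PureTensor L N H :=
    { S := S'
      K := T.K
      loc := T.loc
      arch := T.arch
      loc_eq_indicator := fun v hv => T.loc_eq_indicator v fun hvS => hv (hS hvS) }
  rw [← eval_eq_of_subset T T' hS (fun _ => rfl) (fun _ => rfl) rfl]
  exact h T' hK

open scoped Classical in
/-- The same factorisation with the extra factors evaluated: for `v ∈ S′ ∖ T.S`, `∫ f_v dm_v = m_v(K_v)` (levels
measurable — e.g. open or closed subgroups), so
`∫ T.eval dν = κ · (∫ f_∞ dμ_∞) · (∏_{v ∈ T.S} ∫ f_v dm_v) · ∏_{v ∈ S′ ∖ T.S} m_v(K_v)`.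
[cite: BorelJacquet1979, §4.1] [cite: Rogawski1990, §14.2 p. 233] -/
theorem exists_integral_eval_eq_mul_integral_arch_mul_prod_mul_prod_measureReal
    [MeasurableSpace (adelic (↥(maximalRealSubfield L)) L (IsCMField.complexConj L) N H)]
    [BorelSpace (adelic (↥(maximalRealSubfield L)) L (IsCMField.complexConj L) N H)]
    [MeasurableSpace (UnitaryGroup.arch (↥(maximalRealSubfield L)) L (IsCMField.complexConj L) N H)]
    [BorelSpace (UnitaryGroup.arch (↥(maximalRealSubfield L)) L (IsCMField.complexConj L) N H)]
    [∀ v, MeasurableSpace ((cmDatum L N H).Local v)] [∀ v, BorelSpace ((cmDatum L N H).Local v)]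
    (ν : Measure (adelic (↥(maximalRealSubfield L)) L (IsCMField.complexConj L) N H)) [ν.IsHaarMeasure]
    (μa : Measure (UnitaryGroup.arch (↥(maximalRealSubfield L)) L (IsCMField.complexConj L) N H)) [μa.IsHaarMeasure]
    (m : ∀ v, Measure ((cmDatum L N H).Local v)) [∀ v, (m v).IsHaarMeasure]
    (hm : ∀ v, m v (cmLocalIntegralLevel L N H v) = 1) :
    ∃ κ : ℝ, 0 < κ ∧ ∀ (T : PureTensor L N H) (S' : Finset (HeightOneSpectrum (𝓞 ↥(maximalRealSubfield L)))),
      T.S ⊆ S' → (∀ v ∉ S', T.K v = cmLocalIntegralLevel L N H v) →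
      (∀ v ∈ S', v ∉ T.S → MeasurableSet (T.K v : Set ((cmDatum L N H).Local v))) →
      ∫ g, T.eval g ∂ν = (κ : ℂ) * ((∫ a, T.arch a ∂μa) * ((∏ v ∈ T.S, ∫ x, T.loc v x ∂(m v)) *
        ∏ v ∈ S' \ T.S, ((m v).real (T.K v : Set ((cmDatum L N H).Local v)) : ℂ))) := by
  obtain ⟨κ, hκ, h⟩ :=
    exists_integral_eval_eq_mul_integral_arch_mul_prod_of_subset (L := L) (N := N) (H := H) ν μa m hm
  refine ⟨κ, hκ, fun T S' hS hK hKm => ?_⟩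
  rw [h T S' hS hK, ← Finset.prod_sdiff hS, mul_comm (∏ v ∈ S' \ T.S, ∫ x, T.loc v x ∂(m v))]
  congr 3
  refine Finset.prod_congr rfl fun v hv => ?_
  rw [Finset.mem_sdiff] at hv
  rw [T.loc_eq_indicator v hv.2, integral_indicator_const _ (hKm v hv.1 hv.2), Complex.real_smul, mul_one]

end Literature.NumberTheory.Automorphic.UnitaryGroup.PureTensor

end
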